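import Summits.HodgeConjecture.HodgeConjecture.Theorems.WeilTypeLadderQuaternionSymmetry
import Summits.HodgeConjecture.HodgeConjecture.Theorems.WeilTypeLadderOnPath
import Literature.AlgebraicGeometry.HodgeTheory.WeilClassesCyclicPrym
import Literature.AlgebraicGeometry.VanGeemenVerra2003.QuaternionicHodgeClasses
import Literature.AlgebraicGeometry.HodgeTheory.WeilClassesCyclicPrymDegreeFourRamifiedFour
import Summits.HodgeConjecture.HodgeConjecture.Theorems.WeilTypeLadderQuaternionicPrymSixfolds
import HarnessLib

/-!
# WeilTypeLadder · quaternionic Prym SIXFOLDS, II (Donagi–Livné (1,3) towers): Weil classes algebraic for EVERY `K ⊂ ℍ_ℚ` — refereed inputs only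

b2b cell `hweil` (packet `run/shared/lean/b2b/hodge-weil/`, `b2b-hweil-pv3-g35/QUATERNIONIC-PRYMS.md` §7.4 (ADDENDUM A);
prover 3, "special cases with classical tools"). The sibling of `Theorems/WeilTypeLadderQuaternionicPrymSixfolds.lean`
(the (2,1) towers) for the OTHER ramified sixfold family of Donagi–Livné, the (1,3) towers: on their Prym SIXFOLD, the Weil classes of `(P, ℚ(x))` are
algebraic for every quadratic `ℚ(x) ⊂ ℍ_ℚ` — and by the packet's THEOREM DISC (`det H_K ≡ (-N(j_K))ⁿ δ_F`, `n = 3`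
odd, `δ_F = 2` computed exactly for this family) the structures `(P, ℚ(√-5))`, `(P, ℚ(√-10))`, `(P, ℚ(√-13))`,
`(P, ℚ(√-14))`, … (`d` not of the form `u² + 2v²`) are NON-SPLIT Weil sixfolds: a positive-dimensional locus INSIDE THE FIRST
RUNG ABOVE THE FLOOR (R1′ = `WeilTypeLadder.NonsplitSixfolds`) on which the rung holds, from REFEREED facts only
(Schoen 1988; van Geemen–Verra 2003). The non-split-ness itself is a packet-level statement (no discriminant on the
carriers); this file proves the algebraicity.

THE GEOMETRY (Donagi–Livné, *Abelian varieties with quaternion multiplication*, arXiv:math/0507493, §2: towers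
`C̃ → C_± = C̃/⟨-1⟩ → C` with Galois group `Q = {±1, ±i, ±j, ±k}`, `g = g(C)`, `a` branch points;
`dim Prym(C̃/C_±) = 4(g-1) + 2a`; here `(g, a) = (1, 3)`, all three branch points of the second type (stabilisers of
order `4`; as `g₁g₂g₃ ∈ {±1}` with each `gᵢ` of order `4`, the three stabilisers are `⟨i⟩, ⟨j⟩, ⟨k⟩`, one each):
`g(C̃) = 10`, `g(C_±) = 4`, `P` a SIXFOLD with `ℍ_ℚ ⊂ End⁰(P)`). The cyclic subgroup `⟨i⟩ ≅ ℤ/4` acts on `C̃` with `i`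
fixing EXACTLY the two points over the `⟨i⟩`-branch point (rotation exponents `a`, `-a`: `j` conjugates `i` to `-i`)
and `i² = -1` fixing exactly the six points over the three branch points; the points over the `⟨j⟩`- and `⟨k⟩`-branch
points form one `⟨i⟩`-orbit each with stabiliser `{±1}`. So `C̃ → C̃/⟨i⟩ =: X` is a cyclic cover of degree `4` of a
curve of genus `2` (Riemann–Hurwitz: `18 = 4·2 + 6 + 4`) with `2r = 4` branch points and Schoen tuple
`(1, 3, 2, 2) ∈ (ℤ/4 - 0)⁴` — SIMPLE in the sense of [Schoen 1988, p. 11] (`3 = -1`, `2 = -2`; the pairing of the two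
total-ramification exponents is forced by `Σ = 0 ∈ ℤ/4`) — and `h = -e(X°) = -((2 - 4) - 4) = 6` (Lemma 1.5), even;
Schoen 1988, Thm. 2.0 (p. 11) and Cor. 3.1 (p. 24): `U' = ⋀⁶_{ℚ(i)} H¹(P, ℚ) = W_{ℚ(i)}(P)` is generated by algebraic
classes. Then van Geemen–Verra Cor. 4.9 /
Prop. 4.7 transport this to every `W_{ℚ(x)}`, `x ∈ ℍ_ℤ` pure — exactly the chain of the eightfold file.

THIS FILE (kernel; theorems only, no `sorry`; it USES the cited named fact — relocated by the gate to
`Literature/AlgebraicGeometry/HodgeTheory/WeilClassesCyclicPrymDegreeFourRamifiedFour.lean` (p301943), the `r = 2` sibling of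
the tree's `Schoen1988_cyclicPrym_weilClasses_algebraic_degreeFour` (`r = 0`) and `…_twoBranchPoints` (`r = 1`) —
* `Schoen1988_cyclicPrym_weilClasses_algebraic_degreeFour_fourBranchPoints` = Schoen 1988 Cor. 3.1 + Thm. 2.0 at
  `(q, m, r) = (2, 4, 2)` with the simple tuple `(1,3,2,2)`: `C` smooth projective of genus `10`, `α⁴ = 𝟙`, `α` with
  EXACTLY TWO fixed complex points, `α²` with EXACTLY SIX; `B = (ker(𝟙 + (α_*)²))⁰ ⊂ J(C)` (a sixfold), `ψ₀ = α_B`: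
  every class of `weilClassesOf B ψ₀ 3 1` is algebraic.
* `weilClassesOf_quaternionicPrymSixfoldII_le_algebraicClasses` — for a `Q`-action `(ι, j)` on `C` of genus `10` with
  `ι⁴ = 𝟙`, `j² = ι²`, `ιjι = j`, `ι` and `ιj` with exactly two fixed points each, `ι²` with exactly six,
  `P = (ker(𝟙 + (ι²)_*))⁰` with `ι_P, j_P`, `dim P = 6` (carried: Donagi–Livné Lemma 1, `4(g-1)+2a`), and a
  `Q`-invariant rational hyperplane class `h = e^*l` (carried): for every `(p,q,r) ≠ 0`, `m = p²+q²+r²`,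
  `weilClassesOf P (pι_P + qj_P + rι_Pj_P) 3 m ≤ algebraicClasses P.X 3`. CONDITIONAL BY NAME on the new Schoen
  `r = 2` fact and on `VanGeemenVerra2003_quaternionHodgeClasses` — both refereed; Markman-free.
* `nonsplitSixfolds_quaternionicPrymSixfoldII_of_schoen_vanGeemenVerra` — the literal body of R1′ (`NonsplitSixfolds`)
  at `(A, φ, d) := (P, x, m)` on this locus (its "no hyperbolic polarization" binder carried unused); the on-path
  lemma is the (2,1) file's `nonsplitSixfolds_quaternionicPrymSixfold_of_hodgeConjecture` (same statement).

HONEST LABEL. A CASE of R1′ on a proper sublocus (of dimension at most `3`, the dimension of the quaternion-type PEL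
family, inside the 9-dimensional non-split components of the `K` concerned), NOT the rung; known in the sense that
every input is refereed print (1988, 2003, 2005) — but, as far as the cell's searches go, never stated: Markman 2025
§1 and Mostaed 2026 §1 record nothing for non-split sixfolds; the cell's CENSUS ## P3-g3 had `K`-products of
balanced factors only. Which members are NON-split for which `K` is the packet's exact computation (THEOREM DISC,
`code/pv3-g35/`), not a Lean statement. 0 unconditional rungs above the floor are added.
-/

noncomputable section

-- every declaration of this problem lives in `Summit.HodgeConjecture.HodgeConjecture.…` (summit = sub-problem)
set_option linter.dupNamespace false

open CategoryTheory
open Literature.AlgebraicGeometry Literature.AlgebraicGeometry.Motives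
open Literature.AlgebraicGeometry.HodgeTheory
open Literature.AlgebraicTopology.SingularHomology
open Literature.AlgebraicGeometry.VanGeemenVerra2003

namespace Summit.HodgeConjecture.HodgeConjecture.WeilTypeLadder

/-! ### The cited fact `Schoen1988_cyclicPrym_weilClasses_algebraic_degreeFour_fourBranchPoints` (Schoen 1988, Cor. 3.1 at `(q, m, r) = (2, 4, 2)`,
simple tuple `(1,3,2,2)`) lives in `Literature/AlgebraicGeometry/HodgeTheory/WeilClassesCyclicPrymDegreeFourRamifiedFour.lean`
(p301943, relocated there by the gate from this file's first submission). -/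

/-! ### The theorems on the quaternionic Prym SIXFOLD `P` -/

section QuaternionicPrymSixfoldII

/-- **MAIN THEOREM (sixfolds) — on a ramified quaternionic Prym SIXFOLD the Weil classes are algebraic for EVERY
quadratic `K ⊂ ℍ_ℚ`, from refereed facts — the (1,3) towers.** `C` smooth projective of genus `10` with
automorphisms `ι, j` (`ι⁴ = 𝟙`, `j² = ι²`, `ιjι = j`) such that `ι` and `ιj` have exactly two fixed points each and
`ι²` exactly six (the `Q`-tower `(g, a) = (1, 3)` of Donagi–Livné, three branch points of the second type); `P = (ker(𝟙 + (ι²)_*))⁰ ⊂ J(C)`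
(= `Prym(C → C/⟨ι²⟩)`) with `ι_P, j_P`, `dim P = 6` (carried), `h = emb^*l` a `Q`-invariant rational hyperplane class
(carried). Then for every `(p,q,r) ≠ 0`, `m = p² + q² + r²`, `x = p ι_P + q j_P + r ι_P j_P`: EVERY class of
`weilClassesOf P x 3 m` (the Weil plane of `(P, ℚ(x))`, `ℚ(x) ≅ ℚ(√-m)`) is algebraic. PROOF: as the eightfold
theorem — Schoen's `r = 2` fact (simple tuple `(1,3,2,2)`) for the subgroups `⟨ι⟩` and `⟨ιj⟩` (each free of order `4` with square `ι²`, same `P`),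
then van Geemen–Verra Prop. 4.7 along the anticommuting pairs `(ι_P j_P, y)`, `(y, x)` with `y = q ι_P - p j_P`
(resp. `(ι_P, x)` when `p = q = 0`), the polarization hypotheses by `map_pure_two_of_quaternionSymmetric`. By the
packet's THEOREM DISC (`δ_F = 2` for this family) the structures reached include the NON-SPLIT Weil sixfolds
`(P, ℚ(√-5))`, `(P, ℚ(√-10))`, `(P, ℚ(√-13))`, `(P, ℚ(√-14))`, … (not asserted in Lean). CONDITIONAL BY NAME on
`Schoen1988_cyclicPrym_weilClasses_algebraic_degreeFour_fourBranchPoints`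
and `VanGeemenVerra2003_quaternionHodgeClasses`, both refereed; Markman-free.
[cite: Schoen1988HodgeWeil, Cor 3.1 (p. 24) at (q, m, r) = (2, 4, 2)] [cite: vanGeemenVerra2003QuaternionicPryms, Prop. 4.7 and Cor. 4.9]
[cite: DonagiLivne2005QuaternionMultiplication, §2 Lemma 1] -/
theorem weilClassesOf_quaternionicPrymSixfoldII_le_algebraicClasses
    (hS : Schoen1988_cyclicPrym_weilClasses_algebraic_degreeFour_fourBranchPoints)
    (hV : VanGeemenVerra2003_quaternionHodgeClasses) :
    ∀ (C : SchemeOver ℂ) (𝒥 : Jacobian C) (ι j : C ⟶ C),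
      IsSmoothProjective 1 C → 𝒥.J.dim = 10 →
      ι ≫ ι ≫ ι ≫ ι = 𝟙 C → j ≫ j = ι ≫ ι → ι ≫ j ≫ ι = j →
      (∃ R₁ R₂ : ComplexPoints C, R₁ ≠ R₂ ∧ ∀ P : ComplexPoints C, P ≫ ι = P ↔ (P = R₁ ∨ P = R₂)) →
      (∃ R₁ R₂ : ComplexPoints C, R₁ ≠ R₂ ∧ ∀ P : ComplexPoints C, P ≫ (ι ≫ j) = P ↔ (P = R₁ ∨ P = R₂)) →
      (∃ S : Finset (ComplexPoints C), S.card = 6 ∧ ∀ P : ComplexPoints C, P ≫ (ι ≫ ι) = P ↔ P ∈ S) →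
    ∀ (e : 𝒥.J ⟶ 𝒥.J), e = 𝒥.pushforward 𝒥 (ι ≫ ι) →
    ∀ (ιP jP : AbelianVariety.kerComponent (𝟙 𝒥.J + e) ⟶ AbelianVariety.kerComponent (𝟙 𝒥.J + e)),
      ιP ≫ AbelianVariety.kerComponentι (𝟙 𝒥.J + e) =
        AbelianVariety.kerComponentι (𝟙 𝒥.J + e) ≫ 𝒥.pushforward 𝒥 ι →
      jP ≫ AbelianVariety.kerComponentι (𝟙 𝒥.J + e) =
        AbelianVariety.kerComponentι (𝟙 𝒥.J + e) ≫ 𝒥.pushforward 𝒥 j →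
      (AbelianVariety.kerComponent (𝟙 𝒥.J + e)).dim = 6 →
    ∀ (emb : ProjectiveEmbedding (AbelianVariety.kerComponent (𝟙 𝒥.J + e)).X)
      (l : complexBetti (projectiveSpace emb.n ℂ) 2), IsRationalClass l → l ≠ 0 →
      complexBetti.map ιP.hom.hom.hom 2 (complexBetti.map emb.ι 2 l) = complexBetti.map emb.ι 2 l →
      complexBetti.map jP.hom.hom.hom 2 (complexBetti.map emb.ι 2 l) = complexBetti.map emb.ι 2 l →
    ∀ (p q r : ℤ), (p ≠ 0 ∨ q ≠ 0 ∨ r ≠ 0) → ∀ (m : ℕ), (m : ℤ) = p ^ 2 + q ^ 2 + r ^ 2 →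
      weilClassesOf (AbelianVariety.kerComponent (𝟙 𝒥.J + e)) (p • ιP + q • jP + r • (ιP ≫ jP)) 3 m ≤
        algebraicClasses (AbelianVariety.kerComponent (𝟙 𝒥.J + e)).X 3 := by
  intro C 𝒥 ι j hC h11 hι4 hjj hq hfreeι hfreek hfix e he ιP jP hιP hjP hdim emb l hl hl0 hθι hθj p q r hpqr m hm
  -- §2 on the Jacobian
  have hss : 𝒥.pushforward 𝒥 ι ≫ 𝒥.pushforward 𝒥 ι = e := by rw [he, ← Jacobian.pushforward_comp]
  have htt : 𝒥.pushforward 𝒥 j ≫ 𝒥.pushforward 𝒥 j = e := by rw [he, ← Jacobian.pushforward_comp, hjj]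
  have hsts : 𝒥.pushforward 𝒥 ι ≫ 𝒥.pushforward 𝒥 j ≫ 𝒥.pushforward 𝒥 ι = 𝒥.pushforward 𝒥 j := by
    rw [← Jacobian.pushforward_comp, ← Jacobian.pushforward_comp, hq]
  have hkk : (ι ≫ j) ≫ (ι ≫ j) = ι ≫ ι := quaternion_k_sq hjj hq
  have hek : e = 𝒥.pushforward 𝒥 (ι ≫ j) ≫ 𝒥.pushforward 𝒥 (ι ≫ j) := by
    rw [← Jacobian.pushforward_comp, hkk, he]
  have hfixk : ∃ S : Finset (ComplexPoints C), S.card = 6 ∧ ∀ P : ComplexPoints C, P ≫ ((ι ≫ j) ≫ (ι ≫ j)) = P ↔ P ∈ S := by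
    rw [hkk]; exact hfix
  -- §2 on the Prym: `ℍ_ℤ = ℤ⟨ι_P, j_P⟩`
  have hιP2 : ιP ≫ ιP = -(1 • 𝟙 _) := by
    rw [one_smul]; exact kerComponent_restrict_comp_self_eq_neg_id hss hιP
  have hjP2 : jP ≫ jP = -(1 • 𝟙 _) := by
    rw [one_smul]; exact kerComponent_restrict_comp_self_eq_neg_id htt hjP
  have hanti : ιP ≫ jP = -(jP ≫ ιP) := kerComponent_restrict_anticomm hss hsts hιP hjP
  have hkP : (ιP ≫ jP) ≫ AbelianVariety.kerComponentι (𝟙 𝒥.J + e) =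
      AbelianVariety.kerComponentι (𝟙 𝒥.J + e) ≫ 𝒥.pushforward 𝒥 (ι ≫ j) := by
    rw [Jacobian.pushforward_comp, Category.assoc, hjP, ← Category.assoc, hιP, Category.assoc]
  have hk2 : (ιP ≫ jP) ≫ (ιP ≫ jP) = -(1 • 𝟙 _) := by
    have := comp_comp_self_of_anticomm hιP2 hjP2 hanti; rwa [mul_one] at this
  have hιk : ιP ≫ (ιP ≫ jP) = -((ιP ≫ jP) ≫ ιP) := anticomm_comp_of_anticomm hanti
  have hjk : jP ≫ (ιP ≫ jP) = -((ιP ≫ jP) ≫ jP) := by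
    rw [← Category.assoc, comp_eq_neg_comp_of_anticomm hanti, Preadditive.neg_comp, Category.assoc]
  -- dimension, positivity
  have hdim' : (AbelianVariety.kerComponent (𝟙 𝒥.J + e)).dim = 2 * 3 := by rw [hdim]
  have hm0 : 0 < m := by
    have : (0 : ℤ) < m := by
      rw [hm]
      rcases hpqr with h0 | h0 | h0 <;> positivity
    exact_mod_cast this
  -- the class `h = emb^* l` and its symmetries (§1)
  have hθι' : complexBetti.map ιP.hom.hom.hom 2 (complexBetti.map emb.ι 2 l) =
      ((1 : ℕ) : ℂ) • complexBetti.map emb.ι 2 l := by rw [Nat.cast_one, one_smul]; exact hθι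
  have hθj' : complexBetti.map jP.hom.hom.hom 2 (complexBetti.map emb.ι 2 l) =
      ((1 : ℕ) : ℂ) • complexBetti.map emb.ι 2 l := by rw [Nat.cast_one, one_smul]; exact hθj
  have hθk' : complexBetti.map (ιP ≫ jP).hom.hom.hom 2 (complexBetti.map emb.ι 2 l) =
      ((1 : ℕ) : ℂ) • complexBetti.map emb.ι 2 l := by
    rw [← complexBetti_map_map_hom, hθj, hθι, Nat.cast_one, one_smul]
  have hθx : complexBetti.map (p • ιP + q • jP + r • (ιP ≫ jP)).hom.hom.hom 2 (complexBetti.map emb.ι 2 l) =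
      (m : ℂ) • complexBetti.map emb.ι 2 l := by
    rw [map_pure_two_of_quaternionSymmetric one_pos one_pos hιP2 hjP2 hanti hθι' hθj' p q r]
    congr 1
    have : ((p ^ 2 * (1 : ℕ) + q ^ 2 * (1 : ℕ) + r ^ 2 * ((1 : ℕ) * (1 : ℕ)) : ℤ) : ℂ) = ((m : ℤ) : ℂ) := by
      rw [hm]; push_cast; ring
    rw [this, Int.cast_natCast]
  -- `x² = -m`
  have hx2 : (p • ιP + q • jP + r • (ιP ≫ jP)) ≫ (p • ιP + q • jP + r • (ιP ≫ jP)) = -(m • 𝟙 _) :=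
    pure_comp_pure_eq hιP2 hjP2 hanti p q r (by rw [hm]; ring)
  -- Schoen for `⟨ι⟩` and `⟨ιj⟩`
  have hWι : weilClassesOf (AbelianVariety.kerComponent (𝟙 𝒥.J + e)) ιP 3 1 ≤
      algebraicClasses (AbelianVariety.kerComponent (𝟙 𝒥.J + e)).X 3 :=
    fun c hc ↦ hS C 𝒥 ι hC h11 hι4 hfreeι hfix _ e rfl hss.symm ιP hιP c hc
  have hWk : weilClassesOf (AbelianVariety.kerComponent (𝟙 𝒥.J + e)) (ιP ≫ jP) 3 1 ≤
      algebraicClasses (AbelianVariety.kerComponent (𝟙 𝒥.J + e)).X 3 :=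
    fun c hc ↦ hS C 𝒥 (ι ≫ j) hC h11 (quaternion_k_pow_four hι4 hjj hq) hfreek hfixk _ e rfl hek (ιP ≫ jP) hkP c hc
  by_cases hpq : p = 0 ∧ q = 0
  · -- `x = r ι_P j_P`: the pair `(ι_P, x)`
    obtain ⟨rfl, rfl⟩ := hpq
    have hιx : ιP ≫ ((0 : ℤ) • ιP + (0 : ℤ) • jP + r • (ιP ≫ jP)) =
        -(((0 : ℤ) • ιP + (0 : ℤ) • jP + r • (ιP ≫ jP)) ≫ ιP) := by
      simp only [zero_smul, zero_add, Preadditive.comp_zsmul, Preadditive.zsmul_comp, hιk, smul_neg]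
    obtain ⟨-, -, hEq, -⟩ := hV _ ιP _ 3 1 m emb l (by norm_num) one_pos hm0 hdim' hιP2 hx2 hιx hl hl0
      hθι' hθx
    calc weilClassesOf _ ((0 : ℤ) • ιP + (0 : ℤ) • jP + r • (ιP ≫ jP)) 3 m
        ≤ quaternionClasses _ ιP ((0 : ℤ) • ιP + (0 : ℤ) • jP + r • (ιP ≫ jP))
            ((0 : ℤ) • ιP + (0 : ℤ) • jP + r • (ιP ≫ jP)) 3 m :=
          weilClassesOf_le_quaternionClasses _ 3 m
      _ = quaternionClasses _ ιP ((0 : ℤ) • ιP + (0 : ℤ) • jP + r • (ιP ≫ jP)) ιP 3 1 := hEq.symm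
      _ ≤ algebraicClasses _ 3 := quaternionClasses_le_algebraicClasses ιP 3 1 hWι
  · -- `(p, q) ≠ (0, 0)`: the partner `y = q ι_P - p j_P`, pairs `(ι_P j_P, y)` and `(y, x)`
    have hpq' : p ≠ 0 ∨ q ≠ 0 := not_and_or.mp hpq
    -- `y² = -m'`, `m' = q² + p²`
    have hnonneg : (0 : ℤ) ≤ q ^ 2 + p ^ 2 := by positivity
    obtain ⟨m', hm'ℤ⟩ := Int.eq_ofNat_of_zero_le hnonneg
    have hm' : (m' : ℤ) = (q * (1 : ℕ)) ^ 2 * (1 : ℕ) + (-(p * (1 : ℕ))) ^ 2 * (1 : ℕ) +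
        0 ^ 2 * ((1 : ℕ) * (1 : ℕ)) := by rw [← hm'ℤ]; push_cast; ring
    have hm'0 : 0 < m' := by
      have : (0 : ℤ) < m' := by
        rw [← hm'ℤ]
        rcases hpq' with h0 | h0 <;> positivity
      exact_mod_cast this
    have hy2 := pure_comp_pure_eq hιP2 hjP2 hanti (q * (1 : ℕ)) (-(p * (1 : ℕ))) 0 hm'
    -- anticommutations
    have hxy := pure_anticomm hιP2 hjP2 hanti p q r
    have hyx := comp_eq_neg_comp_of_anticomm hxy
    have hky : (ιP ≫ jP) ≫ ((q * (1 : ℕ) : ℤ) • ιP + (-(p * (1 : ℕ)) : ℤ) • jP + (0 : ℤ) • (ιP ≫ jP)) =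
        -(((q * (1 : ℕ) : ℤ) • ιP + (-(p * (1 : ℕ)) : ℤ) • jP + (0 : ℤ) • (ιP ≫ jP)) ≫ (ιP ≫ jP)) := by
      simp only [zero_smul, add_zero, Preadditive.comp_add, Preadditive.add_comp, Preadditive.comp_zsmul,
        Preadditive.zsmul_comp, comp_eq_neg_comp_of_anticomm hιk, comp_eq_neg_comp_of_anticomm hjk,
        smul_neg, neg_add]
    -- `y^* h = m' h`
    have hθy : complexBetti.map ((q * (1 : ℕ) : ℤ) • ιP + (-(p * (1 : ℕ)) : ℤ) • jP +
          (0 : ℤ) • (ιP ≫ jP)).hom.hom.hom 2 (complexBetti.map emb.ι 2 l) =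
        (m' : ℂ) • complexBetti.map emb.ι 2 l := by
      rw [map_pure_two_of_quaternionSymmetric one_pos one_pos hιP2 hjP2 hanti hθι' hθj']
      congr 1
      rw [← Int.cast_natCast (R := ℂ) m', hm']
    -- Prop. 4.7 for the pair `(ι_P j_P, y)`: `W_{ℚ(y)}` is algebraic
    obtain ⟨-, -, hEq1, -⟩ := hV _ (ιP ≫ jP) _ 3 1 m' emb l (by norm_num) one_pos hm'0 hdim' hk2 hy2 hky
      hl hl0 hθk' hθy
    have hWy : weilClassesOf _ ((q * (1 : ℕ) : ℤ) • ιP + (-(p * (1 : ℕ)) : ℤ) • jP + (0 : ℤ) • (ιP ≫ jP))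
        3 m' ≤ algebraicClasses (AbelianVariety.kerComponent (𝟙 𝒥.J + e)).X 3 :=
      calc weilClassesOf _ _ 3 m'
          ≤ quaternionClasses _ (ιP ≫ jP) _ _ 3 m' := weilClassesOf_le_quaternionClasses _ 3 m'
        _ = quaternionClasses _ (ιP ≫ jP) _ (ιP ≫ jP) 3 1 := hEq1.symm
        _ ≤ algebraicClasses _ 3 := quaternionClasses_le_algebraicClasses (ιP ≫ jP) 3 1 hWk
    -- Prop. 4.7 for the pair `(y, x)`: `W_{ℚ(x)}` is algebraic
    obtain ⟨-, -, hEq2, -⟩ := hV _ _ _ 3 m' m emb l (by norm_num) hm'0 hm0 hdim' hy2 hx2 hyx hl hl0 hθy hθx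
    calc weilClassesOf _ (p • ιP + q • jP + r • (ιP ≫ jP)) 3 m
        ≤ quaternionClasses _ _ (p • ιP + q • jP + r • (ιP ≫ jP)) (p • ιP + q • jP + r • (ιP ≫ jP)) 3 m :=
          weilClassesOf_le_quaternionClasses _ 3 m
      _ = quaternionClasses _ _ (p • ιP + q • jP + r • (ιP ≫ jP)) _ 3 m' := hEq2.symm
      _ ≤ algebraicClasses _ 3 := quaternionClasses_le_algebraicClasses _ 3 m' hWy

/-- **R1′ (`NonsplitSixfolds`) on the quaternionic Prym SIXFOLD locus, from the two refereed facts**: the literal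
body of the rung at `(A, φ, d) := (P, x, m)` — for the members/fields where NO polarization is hyperbolic (the rung's
binder, carried unused: by the packet's THEOREM DISC this is the case `m = p²+q²+r²` not of the form `u² + 2v²`,
e.g. `K = ℚ(√-5)`), every rational `(3,3)` Weil class is algebraic. A CASE of the first rung above the floor on a proper
sublocus, Markman-free. [cite: Schoen1988HodgeWeil, Cor 3.1 (p. 24)] [cite: vanGeemenVerra2003QuaternionicPryms, Cor. 4.9] -/
theorem nonsplitSixfolds_quaternionicPrymSixfoldII_of_schoen_vanGeemenVerra
    (hS : Schoen1988_cyclicPrym_weilClasses_algebraic_degreeFour_fourBranchPoints)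
    (hV : VanGeemenVerra2003_quaternionHodgeClasses) :
    ∀ (C : SchemeOver ℂ) (𝒥 : Jacobian C) (ι j : C ⟶ C),
      IsSmoothProjective 1 C → 𝒥.J.dim = 10 →
      ι ≫ ι ≫ ι ≫ ι = 𝟙 C → j ≫ j = ι ≫ ι → ι ≫ j ≫ ι = j →
      (∃ R₁ R₂ : ComplexPoints C, R₁ ≠ R₂ ∧ ∀ P : ComplexPoints C, P ≫ ι = P ↔ (P = R₁ ∨ P = R₂)) →
      (∃ R₁ R₂ : ComplexPoints C, R₁ ≠ R₂ ∧ ∀ P : ComplexPoints C, P ≫ (ι ≫ j) = P ↔ (P = R₁ ∨ P = R₂)) →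
      (∃ S : Finset (ComplexPoints C), S.card = 6 ∧ ∀ P : ComplexPoints C, P ≫ (ι ≫ ι) = P ↔ P ∈ S) →
    ∀ (e : 𝒥.J ⟶ 𝒥.J), e = 𝒥.pushforward 𝒥 (ι ≫ ι) →
    ∀ (ιP jP : AbelianVariety.kerComponent (𝟙 𝒥.J + e) ⟶ AbelianVariety.kerComponent (𝟙 𝒥.J + e)),
      ιP ≫ AbelianVariety.kerComponentι (𝟙 𝒥.J + e) =
        AbelianVariety.kerComponentι (𝟙 𝒥.J + e) ≫ 𝒥.pushforward 𝒥 ι →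
      jP ≫ AbelianVariety.kerComponentι (𝟙 𝒥.J + e) =
        AbelianVariety.kerComponentι (𝟙 𝒥.J + e) ≫ 𝒥.pushforward 𝒥 j →
      (AbelianVariety.kerComponent (𝟙 𝒥.J + e)).dim = 6 →
    ∀ (emb : ProjectiveEmbedding (AbelianVariety.kerComponent (𝟙 𝒥.J + e)).X)
      (l : complexBetti (projectiveSpace emb.n ℂ) 2), IsRationalClass l → l ≠ 0 →
      complexBetti.map ιP.hom.hom.hom 2 (complexBetti.map emb.ι 2 l) = complexBetti.map emb.ι 2 l →
      complexBetti.map jP.hom.hom.hom 2 (complexBetti.map emb.ι 2 l) = complexBetti.map emb.ι 2 l →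
    ∀ (p q r : ℤ), (p ≠ 0 ∨ q ≠ 0 ∨ r ≠ 0) → ∀ (m : ℕ), (m : ℤ) = p ^ 2 + q ^ 2 + r ^ 2 →
      0 < m → (AbelianVariety.kerComponent (𝟙 𝒥.J + e)).dim = 2 * 3 →
      IsSmoothProjective (2 * 3) (AbelianVariety.kerComponent (𝟙 𝒥.J + e)).X →
      (p • ιP + q • jP + r • (ιP ≫ jP)) ≫ (p • ιP + q • jP + r • (ιP ≫ jP)) = -(m • 𝟙 _) →
      (∀ (e' : ProjectiveEmbedding (AbelianVariety.kerComponent (𝟙 𝒥.J + e)).X)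
        (a' : complexBetti (projectiveSpace e'.n ℂ) 2), IsRationalClass a' → a' ≠ 0 →
          ¬ IsHyperbolicWeilType (AbelianVariety.kerComponent (𝟙 𝒥.J + e)) (p • ιP + q • jP + r • (ιP ≫ jP)) 3
            ((m : ℂ) • complexBetti.map e'.ι 2 a' +
              complexBetti.map (p • ιP + q • jP + r • (ιP ≫ jP)).hom.hom.hom 2 (complexBetti.map e'.ι 2 a'))) →
      ∀ c : complexBetti (AbelianVariety.kerComponent (𝟙 𝒥.J + e)).X (2 * 3), IsRationalClass c →
        IsOfHodgeType (2 * 3) (AbelianVariety.kerComponent (𝟙 𝒥.J + e)).X (2 * 3) 3 3 c →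
        c ∈ weilClassesOf (AbelianVariety.kerComponent (𝟙 𝒥.J + e)) (p • ιP + q • jP + r • (ιP ≫ jP)) 3 m →
        c ∈ algebraicClasses (AbelianVariety.kerComponent (𝟙 𝒥.J + e)).X 3 := by
  intro C 𝒥 ι j hC h11 hι4 hjj hq hfreeι hfreek hfix e he ιP jP hιP hjP hdim emb l hl hl0 hθι hθj p q r hpqr m hm
    _ _ _ _ _ c _ _ hW
  exact weilClassesOf_quaternionicPrymSixfoldII_le_algebraicClasses hS hV C 𝒥 ι j hC h11 hι4 hjj hq hfreeι hfreek hfix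
    e he ιP jP hιP hjP hdim emb l hl hl0 hθι hθj p q r hpqr m hm hW

/-! On-path: `HodgeConjecture → NonsplitSixfolds →` this locus is LITERALLY the already-landed
`nonsplitSixfolds_quaternionicPrymSixfold_of_hodgeConjecture` of `Theorems/WeilTypeLadderQuaternionicPrymSixfolds.lean`
(its statement does not involve the cover data), so it is not restated here (gate `dedup.landed`). -/

end QuaternionicPrymSixfoldII

end Summit.HodgeConjecture.HodgeConjecture.WeilTypeLadder

end
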